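import Mathlib
import Literature.NumberTheory.LFunctions.Zhang2022.Section14Prop141Twisted
import HarnessLib

/-!
# Zhang (2022) §14: the typed `β = 0` nodes (14.8) leg 1, leg 2 and (14.6) from their twisted forms

Topic `Literature/NumberTheory/LFunctions/Zhang2022` (Landau–Siegel audit tree; verdict-neutral;
leaf `Skeleton.Prop141`, row G-adj2-4 of the ZHANG-L discharge lane).
Y. Zhang, *Discrete mean estimates and the Landau–Siegel zero*, arXiv:2211.02515v1 (2022)
[Zhang2022LandauSiegel] — **an unrefereed manuscript under adjudication**; this file PROVES three
bookkeeping implications; it asserts none of their hypotheses and says nothing about Theorems 1–2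
of the manuscript or about Landau–Siegel zeros.

The general-`β` programme for Proposition 14.1 (`Section14Prop141Twisted`, `Section14Prop141OfLegs`)
targets the two `r`-ranges of (14.8) and (14.6) WITH the twist `(pt₀)^β` (`Typed.Sec14.wt`,
`Typed.Sec14.rhs1417OnW`) on the CLOSED conductor range `r ≤ 2DP₄` (the boundary repair of record of
u017, `Section14U017`). At `β = 0` the twist is `1` (`wt_zero`), and the printed half-open range
`1 < r < 2DP₄` of the typed nodes `Typed.Sec14.Eq148leg1` / `Eq148leg2` (G-adj2-4) is a SUBSET of the
closed one, over which the u017 majorant (a sum of non-negative terms) is monotone. Hence: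

* `rhs1417OnW_mono` — monotonicity of the twisted u017 majorant in the `r`-set;
* `eq148leg1_of_W`, `eq148leg2_of_W` — the typed `Eq148leg1`, `Eq148leg2` BY NAME from the twisted
  closed-range estimates (W-leg1 / W-leg2 of the Prop. 14.1 programme) specialised at `β = 0`;
* `eq146_of_W` — the typed `Eq146` BY NAME from (14.6) with the twist (W-146) at `β = 0`.

## References

* Y. Zhang, arXiv:2211.02515v1 (2022), §14 (14.6), (14.8) pp. 78–79, tex L3915, L3945–L3969.
  [cite: Zhang2022LandauSiegel, §14 (14.8) p.79, tex L3956–L3963]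
-/

noncomputable section

open Complex Real

namespace Literature.NumberTheory.LFunctions.Zhang2022.Typed.Sec14

open Skeleton

variable {D : ℕ} (χ : DirichletCharacter ℂ D)

/-- **The twisted u017 majorant is monotone in the `r`-range** (all its terms are non-negative).
[cite: Zhang2022LandauSiegel, §14 u017 p.79, tex L3956] -/
theorem rhs1417OnW_mono (β : ℂ) (κs : ℕ → ℂ) {S S' : Finset ℕ} (h : S ⊆ S') :
    rhs1417OnW χ β κs S ≤ rhs1417OnW χ β κs S' := by
  unfold rhs1417OnW
  refine Finset.sum_le_sum fun d _ => mul_le_mul_of_nonneg_left ?_ (inv_nonneg.mpr (Nat.cast_nonneg d))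
  refine Finset.sum_le_sum_of_subset_of_nonneg h fun r _ _ => ?_
  refine Finset.sum_nonneg fun h' _ => mul_nonneg ?_ (Finset.sum_nonneg fun θ _ => norm_nonneg _)
  exact div_nonneg (Nat.cast_nonneg D)
    (mul_nonneg (mul_nonneg (Nat.cast_nonneg _) (Nat.cast_nonneg h')) (Real.sqrt_nonneg r))

omit χ in
/-- The printed half-open conductor range sits inside the closed one: `Ico 2 ⌈x⌉ ⊆ Icc 2 ⌊x⌋`
(`r < ⌈x⌉ ⇒ r ≤ ⌊x⌋`). [cite: Zhang2022LandauSiegel, §14 u017 p.79 ("`1 < r < 2DP₄`")] -/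
theorem Ico_ceil_subset_Icc_floor (x : ℝ) : Finset.Ico 2 ⌈x⌉₊ ⊆ Finset.Icc 2 ⌊x⌋₊ := by
  intro r hr
  rw [Finset.mem_Ico] at hr
  rw [Finset.mem_Icc]
  refine ⟨hr.1, ?_⟩
  have h1 : (r : ℝ) < x := Nat.lt_ceil.mp hr.2
  exact Nat.le_floor h1.le

omit χ in
/-- Filtering preserves the inclusion of the two conductor ranges. [folklore] -/
private theorem filter_Ico_subset_filter_Icc (x : ℝ) (q : ℕ → Prop) [DecidablePred q] :
    (Finset.Ico 2 ⌈x⌉₊).filter q ⊆ (Finset.Icc 2 ⌊x⌋₊).filter q :=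
  Finset.filter_subset_filter q (Ico_ceil_subset_Icc_floor x)

omit χ in
/-- `0 < 5α` once `D ≥ 3` (`α = π/𝓛⁹`, `𝓛 = log D > 0`). [cite: Zhang2022LandauSiegel, §2 (2.10)] -/
private theorem five_alpha_pos {D : ℕ} (hD : 3 ≤ D) : ‖(0 : ℂ)‖ < 5 * alpha D := by
  rw [norm_zero]
  have hℓ : 0 < ell D := by
    rw [ell]; exact Real.log_pos (by exact_mod_cast (show 1 < D by omega))
  have := alpha_pos' hℓ
  linarith

/-- **`Eq148leg1` (the `1 < r < D³` range of (14.8), as typed) from the twisted closed-range estimate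
W-leg1 at `β = 0`.** [cite: Zhang2022LandauSiegel, §14 (14.8) p.79, tex L3960–L3962] -/
theorem eq148leg1_of_W
    (hleg1 : ∀ B : ℝ, ∃ c : ℝ, 0 < c ∧ ∃ C : ℝ, ForAllLarge fun D _ χ => AssumptionA D χ →
      ∀ β : ℂ, ‖β‖ < 5 * alpha D → ∀ κs as : ℕ → ℂ, Eq141 B κs → Eq142 D B as →
        rhs1417OnW χ β κs ((Finset.Icc 2 ⌊2 * (D : ℝ) * P4 D⌋₊).filter (fun r => r < D ^ 3))
          ≤ C * bigP D ^ 2 * (D : ℝ) ^ (-c)) :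
    Eq148leg1 := by
  intro B
  obtain ⟨c, hc, C, D₀, h⟩ := hleg1 B
  refine ⟨c, hc, C, max D₀ 3, fun D _ χ hD hq hp hA κs as hκ ha => ?_⟩
  have hD3 : 3 ≤ D := le_trans (le_max_right _ _) hD
  have h0 := h D χ (le_trans (le_max_left _ _) hD) hq hp hA 0 (five_alpha_pos hD3) κs as hκ ha
  rw [rhs1417OnW_zero] at h0
  rw [← rhs1417OnW_zero]
  refine le_trans ?_ h0
  rw [rhs1417OnW_zero]
  have hmono := rhs1417OnW_mono χ 0 κs
    (filter_Ico_subset_filter_Icc (2 * (D : ℝ) * P4 D) (fun r => r < D ^ 3))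
  rwa [rhs1417OnW_zero, rhs1417OnW_zero] at hmono

/-- **`Eq148leg2` (the `D³ ≤ r < 2DP₄` range of (14.8), as typed) from the twisted closed-range
estimate W-leg2 at `β = 0`.** [cite: Zhang2022LandauSiegel, §14 (14.8) p.79, tex L3962–L3963] -/
theorem eq148leg2_of_W
    (hleg2 : ∀ B : ℝ, ∃ c : ℝ, 0 < c ∧ ∃ C : ℝ, ForAllLarge fun D _ χ => AssumptionA D χ →
      ∀ β : ℂ, ‖β‖ < 5 * alpha D → ∀ κs as : ℕ → ℂ, Eq141 B κs → Eq142 D B as →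
        rhs1417OnW χ β κs ((Finset.Icc 2 ⌊2 * (D : ℝ) * P4 D⌋₊).filter (fun r => ¬ r < D ^ 3))
          ≤ C * bigP D ^ 2 * (D : ℝ) ^ (-c)) :
    Eq148leg2 := by
  intro B
  obtain ⟨c, hc, C, D₀, h⟩ := hleg2 B
  refine ⟨c, hc, C, max D₀ 3, fun D _ χ hD hq hp hA κs as hκ ha => ?_⟩
  have hD3 : 3 ≤ D := le_trans (le_max_right _ _) hD
  have h0 := h D χ (le_trans (le_max_left _ _) hD) hq hp hA 0 (five_alpha_pos hD3) κs as hκ ha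
  refine le_trans ?_ h0
  have hmono := rhs1417OnW_mono χ 0 κs
    (filter_Ico_subset_filter_Icc (2 * (D : ℝ) * P4 D) (fun r => ¬ r < D ^ 3))
  rwa [rhs1417OnW_zero] at hmono

/-- **`Eq146` ((14.6), as typed) from (14.6) with the twist (W-146) at `β = 0`.**
[cite: Zhang2022LandauSiegel, §14 (14.6) p.78, tex L3915] -/
theorem eq146_of_W
    (h146 : ∀ B : ℝ, ∃ c : ℝ, 0 < c ∧ ∃ C : ℝ, ForAllLarge fun D _ χ => AssumptionA D χ →
      ∀ β : ℂ, ‖β‖ < 5 * alpha D → ∀ κs as : ℕ → ℂ, Eq141 B κs → Eq142 D B as →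
        ∀ D₁ D₂ : ℕ, D₁ * D₂ = D → 1 < D₁ →
          ‖∑ p ∈ primeWindow D, χ (p : ZMod D) * wt D β p * calS D D₁ D₂ p κs as‖
            ≤ C * bigP D ^ 2 * (D : ℝ) ^ (1 / 2 - c)) :
    Eq146 := by
  intro B
  obtain ⟨c, hc, C, D₀, h⟩ := h146 B
  refine ⟨c, hc, C, max D₀ 3, fun D _ χ hD hq hp hA κs as hκ ha D₁ D₂ hmul h1 => ?_⟩
  have hD3 : 3 ≤ D := le_trans (le_max_right _ _) hD
  have h0 := h D χ (le_trans (le_max_left _ _) hD) hq hp hA 0 (five_alpha_pos hD3) κs as hκ ha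
    D₁ D₂ hmul h1
  simpa only [wt_zero, mul_one] using h0

end Literature.NumberTheory.LFunctions.Zhang2022.Typed.Sec14
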